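import Summits.QuantumFields.YangMills.Theorems.IR.ShellMaxCorrBoundaryTilt
import Summits.QuantumFields.YangMills.Theorems.IR.ShellMaxCorrTorusCount
import Summits.QuantumFields.YangMills.Theorems.IR.ShellMaxCorrKernelAvg
import Literature.Probability.LatticeModels.DobrushinComparisonBoundary

/-!
# Crux `IR` (item stmt-QuantumFields-19354) — line «maximal correlation at one physical thickness»:
(H3) THE GRAM ROWS OF THE ONE-LINK TILTING FACTORS ARE `O(δ²)` UNDER EVERY KERNEL

Helper module for item `stmt-QuantumFields-19354` (`--supports … --as helper`; it closes nothing; lead prover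
ym-ir-line-mxc-p1, g2).  Hypothesis (H3) of the abstract maximal-correlation theorem `HeatBath.integral_sq_kernelAvg_sub_le`
(`Theorems/IR/ShellMaxCorrTransfer.lean`) for the torus weight specification `γ = torusWeightSpec v`, `osc (log v) ≤ δ`,
with Dobrushin row sums `3(d−1)δ ≤ α`, `3^d α ≤ 1/2`: for every volume `Λ`, boundary condition `η`, selection `s` and
link `e ∉ Λ`,

  `∑_{e' ∉ Λ} |Cov_{γ_Λ(η)}(ρ_{e,s_e}, ρ_{e',s_{e'}})| ≤ Λ⋆(d, δ, α)`,  `Λ⋆ = 8(d−1)·[(ρhi − ρlo)² + ρhi (ρhi − ρlo) · d (1 + 2·3^d) α]`,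

`ρhi = e^{2(d−1)δ} = ρlo⁻¹` (`gramRow_torusWeightSpec_le`) — i.e. `Λ⋆ = O(δ²)`, uniformly in `L`, `Λ`, `η`, `s`, `e`.
NEAR pairs (`e'` on a plaquette through `e`, at most `8(d−1)` of them): `|Cov| ≤ (ρhi − ρlo)²`.  FAR pairs: by the tilt
identity (`TorusTilt.integral_torusWeightSpec_update_boundary`) `Cov_{γ_Λ(η)}(ρ_e, ρ_{e'}) = γ_Λ(ρ_{e'})(η) ·
[γ_Λ(ρ_e)(η^{e'←s'}) − γ_Λ(ρ_e)(η)]`, and the change of the kernel under a one-link boundary change is bounded by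
DOBRUSHIN'S COMPARISON THEOREM in the tree's super-solution form (`DobrushinMetric.abs_kernel_sub_le_of_superSolution`,
Georgii Thm. 8.20) with the super-solution `α^{max(1, ‖z − e'‖)}` of `…TorusCount.lean`: `≤ (ρhi − ρlo) ∑_{z ∈ N(e)}
α^{max(1,‖z−e'‖)}`; summing over `e'` with the lattice sum of `…TorusCount.lean` gives `O(δ)·O(α)`.

HONEST FRAMING: a covariance estimate for plaquette-weight kernels in Dobrushin's regime; nothing here proves `ShellRung`
(that is the assembly file), the loads, or any mass gap.

Refs: H.-O. Georgii, *Gibbs Measures and Phase Transitions* (2011), Thm. 8.20; H. Föllmer, LNM 1362 (1988) Ch. I (2.10).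
-/

set_option autoImplicit false

noncomputable section

open MeasureTheory ProbabilityTheory Finset Function Filter Real
open Literature.Probability.LatticeModels Literature.Probability.LatticeModels.DobrushinMetric
open Literature.MathematicalPhysics.QuantumFieldTheory
open Summit.QuantumFields.YangMills.Cruxes.IR.ShellMaxCorr.HeatBath (integral_mul_sub_eq_centred integrable_of_abs_le_const)

namespace Summit.QuantumFields.YangMills.Cruxes.IR.ShellMaxCorr.TorusTilt

variable {d L : ℕ} [NeZero L] {G : Type*} [Group G] [TopologicalSpace G] [IsTopologicalGroup G]
  [CompactSpace G] [MeasurableSpace G] [BorelSpace G] [SecondCountableTopology G] [T2Space G]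

/-! ## §1 Covariances of bounded positive factors -/

/-- **Near pairs**: `|Cov_ν(u, w)| ≤ (hi − lo)²` for measurable `u, w` with values in `[lo, hi]` under a probability
measure. -/
theorem abs_cov_le_sq_of_bounds {Ω : Type*} [MeasurableSpace Ω] (ν : Measure Ω) [IsProbabilityMeasure ν]
    {u w : Ω → ℝ} (hum : Measurable u) (hwm : Measurable w) {lo hi : ℝ} (hlo : 0 ≤ lo)
    (hu : ∀ ω, lo ≤ u ω ∧ u ω ≤ hi) (hw : ∀ ω, lo ≤ w ω ∧ w ω ≤ hi) :
    |(∫ ω, u ω * w ω ∂ν) - (∫ ω, u ω ∂ν) * (∫ ω, w ω ∂ν)| ≤ (hi - lo) ^ 2 := by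
  have hub : ∀ ω, |u ω| ≤ hi := fun ω => by rw [abs_of_nonneg (hlo.trans (hu ω).1)]; exact (hu ω).2
  have hwb : ∀ ω, |w ω| ≤ hi := fun ω => by rw [abs_of_nonneg (hlo.trans (hw ω).1)]; exact (hw ω).2
  rw [integral_mul_sub_eq_centred ν hum hwm hub hwb]
  have hmu : lo ≤ ∫ ω, u ω ∂ν ∧ ∫ ω, u ω ∂ν ≤ hi :=
    ⟨by simpa using integral_mono (integrable_const lo) (integrable_of_abs_le_const ν hum hub) fun ω => (hu ω).1,
     by simpa using integral_mono (integrable_of_abs_le_const ν hum hub) (integrable_const hi) fun ω => (hu ω).2⟩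
  have hmw : lo ≤ ∫ ω, w ω ∂ν ∧ ∫ ω, w ω ∂ν ≤ hi :=
    ⟨by simpa using integral_mono (integrable_const lo) (integrable_of_abs_le_const ν hwm hwb) fun ω => (hw ω).1,
     by simpa using integral_mono (integrable_of_abs_le_const ν hwm hwb) (integrable_const hi) fun ω => (hw ω).2⟩
  have hpt : ∀ ω, |(u ω - ∫ ω', u ω' ∂ν) * (w ω - ∫ ω', w ω' ∂ν)| ≤ (hi - lo) ^ 2 := fun ω => by
    rw [abs_mul, pow_two]
    refine mul_le_mul ?_ ?_ (abs_nonneg _) (by linarith [hmu.1, hmu.2])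
    · exact abs_le.2 ⟨by linarith [(hu ω).1, hmu.2], by linarith [(hu ω).2, hmu.1]⟩
    · exact abs_le.2 ⟨by linarith [(hw ω).1, hmw.2], by linarith [(hw ω).2, hmw.1]⟩
  have h := norm_integral_le_of_norm_le_const (μ := ν)
    (f := fun ω => (u ω - ∫ ω', u ω' ∂ν) * (w ω - ∫ ω', w ω' ∂ν)) (C := (hi - lo) ^ 2)
    (ae_of_all _ fun ω => by rw [Real.norm_eq_abs]; exact hpt ω)
  simpa using h

/-! ## §2 Far pairs: the tilt identity and Dobrushin's comparison theorem -/

section Far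

variable {v : G → ℝ} (hv : Continuous v) (hv0 : ∀ g, 0 < v g) {δ : ℝ}
  (hvδ : ∀ a b, |Real.log (v a) - Real.log (v b)| ≤ δ)

include hv hv0 hvδ

/-- **Far pairs.**  For `e' ∉ Λ` off the plaquette neighbourhood of `e`, with Dobrushin row sums `3(d−1)δ ≤ α < 1`:
`|Cov_{γ_Λ(η)}(ρ_{e,s}, ρ_{e',s'})| ≤ ρhi (ρhi − ρlo) ∑_{z ∈ N(e)} α^{max(1, ‖z.1 − e'.1‖)}`, `ρhi = e^{2(d−1)δ} = ρlo⁻¹`,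
`N(e) = ⋃_{q ∋ e} ∂q`. -/
theorem abs_cov_tilt_far {α : ℝ} (hα : 3 * (d - 1 : ℕ) * δ ≤ α) (hα1 : α < 1) (Λ : Finset (Edge d L))
    (η : GaugeConfig d L G) {e e' : Edge d L} (he' : e' ∉ Λ) (hfar : e' ∉ (plaqsThrough e).biUnion plaqEdgesT)
    (s s' : G) :
    |(∫ σ, Real.exp (torusLogWeight v (update σ e s) - torusLogWeight v σ) *
          Real.exp (torusLogWeight v (update σ e' s') - torusLogWeight v σ) ∂(torusWeightSpec v Λ η)) -
        (∫ σ, Real.exp (torusLogWeight v (update σ e s) - torusLogWeight v σ) ∂(torusWeightSpec v Λ η)) *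
          (∫ σ, Real.exp (torusLogWeight v (update σ e' s') - torusLogWeight v σ) ∂(torusWeightSpec v Λ η))| ≤
      Real.exp (2 * (d - 1 : ℕ) * δ) * (Real.exp (2 * (d - 1 : ℕ) * δ) - Real.exp (-(2 * (d - 1 : ℕ) * δ))) *
        ∑ z ∈ (plaqsThrough e).biUnion plaqEdgesT, α ^ max 1 (torusNorm (z.1 - e'.1)) := by
  classical
  have hγ := isSpecification_torusWeightSpec (d := d) (L := L) hv hv0
  have hC := isKRContraction_torusWeightSpec_linear (d := d) (L := L) hv hv0 hvδ
  haveI := hγ.isProbability Λ η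
  have hδ0 : 0 ≤ δ := (abs_nonneg _).trans (hvδ 1 1)
  have hα0 : 0 ≤ α := le_trans (by positivity) hα
  set D : ℝ := 2 * (d - 1 : ℕ) * δ with hD
  set ρ : GaugeConfig d L G → ℝ := fun σ => Real.exp (torusLogWeight v (update σ e s) - torusLogWeight v σ) with hρ
  set ρ' : GaugeConfig d L G → ℝ := fun σ => Real.exp (torusLogWeight v (update σ e' s') - torusLogWeight v σ)
    with hρ'
  set ν := torusWeightSpec v Λ η with hν
  have hρm : Measurable ρ := measurable_exp_update_sub hv e s
  have hρ'm : Measurable ρ' := measurable_exp_update_sub hv e' s'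
  have hρb : ∀ σ, Real.exp (-D) ≤ ρ σ ∧ ρ σ ≤ Real.exp D := fun σ => exp_update_sub_bounds hvδ e s σ
  have hρ'b : ∀ σ, Real.exp (-D) ≤ ρ' σ ∧ ρ' σ ≤ Real.exp D := fun σ => exp_update_sub_bounds hvδ e' s' σ
  have hρ'abs : ∀ σ, |ρ' σ| ≤ Real.exp D := fun σ => by
    rw [abs_of_pos (Real.exp_pos _)]; exact (hρ'b σ).2
  have hρabs : ∀ σ, |ρ σ| ≤ Real.exp D := fun σ => by
    rw [abs_of_pos (Real.exp_pos _)]; exact (hρb σ).2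
  -- `ρ` is blind to the link `e'`
  have hblind : ∀ σ t, ρ (update σ e' t) = ρ σ := fun σ t => by
    simp only [hρ]; rw [torusLogWeight_update_sub_update_of_not_mem v hfar]
  -- the tilt identity at the boundary link `e'`
  have htilt := integral_torusWeightSpec_update_boundary hv hv0 Λ he' η s' hρm hblind
  -- `Cov = γ_Λ(ρ')(η) · [γ_Λ(ρ)(η^{e'←s'}) − γ_Λ(ρ)(η)]`
  have hcov : (∫ σ, ρ σ * ρ' σ ∂ν) - (∫ σ, ρ σ ∂ν) * (∫ σ, ρ' σ ∂ν) =
      (∫ σ, ρ' σ ∂ν) * ((∫ σ, ρ σ ∂(torusWeightSpec v Λ (update η e' s'))) - ∫ σ, ρ σ ∂ν) := by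
    rw [← htilt]; ring
  -- Dobrushin's comparison with the super-solution around `e'`
  set dS : Edge d L → ℝ := fun z => if z = e' then 1 else α ^ max 1 (torusNorm (z.1 - e'.1)) with hdS
  have hdS0 : ∀ z, 0 ≤ dS z := fun z => by
    simp only [hdS]; split_ifs; exacts [zero_le_one, pow_nonneg hα0 _]
  have hdSe' : 1 ≤ dS e' := by simp [hdS]
  have hrowC : ∀ x : Edge d L, ∑ z ∈ linkNbrT x, (jointPlaq x z : ℝ) * δ / 2 ≤ α := fun x =>
    (sum_linkNbrT_coeff_le_linear hδ0 x).trans hα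
  have hsol : ∀ x ∈ Λ, ∑ z ∈ linkNbrT x, (jointPlaq x z : ℝ) * δ / 2 * dS z ≤ dS x := fun x hx =>
    superSolution_boundaryLink (fun x z => by positivity) hα0 hα1.le hrowC e' x (ne_of_mem_of_not_mem hx he')
  have hrowW : ∀ x ∈ Λ, ∑ z ∈ linkNbrT x, (if z ∈ Λ then (jointPlaq x z : ℝ) * δ / 2 else 0) ≤ α := fun x _ =>
    (sum_le_sum fun z _ => by split_ifs; exacts [le_rfl, by positivity]).trans (hrowC x)
  have hlip : IsLipBound (fun _ _ => (1 : ℝ)) ρ fun _ => Real.exp D - Real.exp (-D) :=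
    ⟨fun _ => sub_nonneg.2 (Real.exp_le_exp.2 (by linarith [mul_nonneg (by positivity : (0:ℝ) ≤ 2 * (d - 1 : ℕ)) hδ0])),
      fun y σ τ _ => by
        rw [mul_one]
        exact abs_le.2 ⟨by linarith [(hρb σ).1, (hρb τ).2], by linarith [(hρb σ).2, (hρb τ).1]⟩⟩
  have hdob := abs_kernel_sub_le_of_superSolution hγ hC (R := 1) (fun _ _ => zero_le_one) (fun _ _ => le_rfl)
    zero_le_one Λ he' (ω := update η e' s') (η := η) (fun z hz => update_of_ne hz _ _) hdS0 hdSe' hsol hα0 hα1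
    hrowW hρm (dependsOn_exp_update_sub v e s) hρabs hlip
  -- on `N(e)` the super-solution is the decaying profile (`e' ∉ N(e)`)
  have hsum : ∑ z ∈ (plaqsThrough e).biUnion plaqEdgesT, dS z * (Real.exp D - Real.exp (-D)) =
      (Real.exp D - Real.exp (-D)) * ∑ z ∈ (plaqsThrough e).biUnion plaqEdgesT, α ^ max 1 (torusNorm (z.1 - e'.1)) := by
    rw [mul_sum]
    refine sum_congr rfl fun z hz => ?_
    have hze : z ≠ e' := fun h => hfar (h ▸ hz)
    simp only [hdS, if_neg hze]
    ring
  rw [one_mul, hsum] at hdob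
  rw [hcov, abs_mul]
  have h1 : |∫ σ, ρ' σ ∂ν| ≤ Real.exp D := hγ.abs_integral_le Λ hρ'abs η
  calc |∫ σ, ρ' σ ∂ν| * |(∫ σ, ρ σ ∂torusWeightSpec v Λ (update η e' s')) - ∫ σ, ρ σ ∂ν|
      ≤ Real.exp D * ((Real.exp D - Real.exp (-D)) *
          ∑ z ∈ (plaqsThrough e).biUnion plaqEdgesT, α ^ max 1 (torusNorm (z.1 - e'.1))) :=
        mul_le_mul h1 hdob (abs_nonneg _) (Real.exp_pos _).le
    _ = _ := by simp only [hD]; ring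

end Far


/-! ## §3 (H3): the Gram rows -/

section Row

variable {v : G → ℝ} (hv : Continuous v) (hv0 : ∀ g, 0 < v g) {δ : ℝ}
  (hvδ : ∀ a b, |Real.log (v a) - Real.log (v b)| ≤ δ)

include hv hv0 hvδ

omit [NeZero L] [Group G] [TopologicalSpace G] [IsTopologicalGroup G] [CompactSpace G] [MeasurableSpace G] [BorelSpace G]
  [SecondCountableTopology G] [T2Space G] hv hv0 hvδ in
/-- The plaquette neighbourhood `N(e) = ⋃_{q ∋ e} ∂q` has at most `8(d−1)` links. -/
theorem card_plaqNbhd_le [NeZero L] (e : Edge d L) : ((plaqsThrough e).biUnion plaqEdgesT).card ≤ 8 * (d - 1) := by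
  calc ((plaqsThrough e).biUnion plaqEdgesT).card ≤ ∑ q ∈ plaqsThrough e, (plaqEdgesT q).card := card_biUnion_le
    _ ≤ ∑ _q ∈ plaqsThrough e, 4 := sum_le_sum fun q _ => card_plaqEdgesT_le q
    _ = (plaqsThrough e).card * 4 := by rw [sum_const, smul_eq_mul]
    _ ≤ 2 * (d - 1) * 4 := Nat.mul_le_mul_right 4 (card_plaqsThrough_le e)
    _ = 8 * (d - 1) := by ring

/-- **(H3) for the torus weight specification.**  With `ρhi = e^{2(d−1)δ}`, `ρlo = e^{−2(d−1)δ}` and Dobrushin row sums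
`3(d−1)δ ≤ α`, `3^d α ≤ 1/2`: for every volume `Λ`, boundary condition `η`, selection `sel` and link `e`,
`∑_{e' ∉ Λ} |Cov_{γ_Λ(η)}(ρ_{e,sel e}, ρ_{e',sel e'})| ≤ 8(d−1)·[(ρhi − ρlo)² + ρhi (ρhi − ρlo) · d (1 + 2·3^d) α]`. -/
theorem gramRow_torusWeightSpec_le {α : ℝ} (hα : 3 * (d - 1 : ℕ) * δ ≤ α) (hα2 : (3 : ℝ) ^ d * α ≤ 1 / 2)
    (Λ : Finset (Edge d L)) (η : GaugeConfig d L G) (sel : Edge d L → G) (e : Edge d L) :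
    ∑ e' ∈ Λᶜ, |(∫ σ, Real.exp (torusLogWeight v (update σ e (sel e)) - torusLogWeight v σ) *
          Real.exp (torusLogWeight v (update σ e' (sel e')) - torusLogWeight v σ) ∂(torusWeightSpec v Λ η)) -
        (∫ σ, Real.exp (torusLogWeight v (update σ e (sel e)) - torusLogWeight v σ) ∂(torusWeightSpec v Λ η)) *
          (∫ σ, Real.exp (torusLogWeight v (update σ e' (sel e')) - torusLogWeight v σ) ∂(torusWeightSpec v Λ η))| ≤
      8 * (d - 1 : ℕ) * ((Real.exp (2 * (d - 1 : ℕ) * δ) - Real.exp (-(2 * (d - 1 : ℕ) * δ))) ^ 2 +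
        Real.exp (2 * (d - 1 : ℕ) * δ) * (Real.exp (2 * (d - 1 : ℕ) * δ) - Real.exp (-(2 * (d - 1 : ℕ) * δ))) *
          (d * ((1 + 2 * (3 : ℝ) ^ d) * α))) := by
  classical
  have hγ := isSpecification_torusWeightSpec (d := d) (L := L) hv hv0
  haveI := hγ.isProbability Λ η
  have hδ0 : 0 ≤ δ := (abs_nonneg _).trans (hvδ 1 1)
  have hα0 : 0 ≤ α := le_trans (by positivity) hα
  have hα1 : α < 1 := by
    have h3 : (1 : ℝ) ≤ (3 : ℝ) ^ d := one_le_pow₀ (by norm_num)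
    nlinarith
  set D : ℝ := 2 * (d - 1 : ℕ) * δ with hD
  set ν := torusWeightSpec v Λ η with hν
  set N : Finset (Edge d L) := (plaqsThrough e).biUnion plaqEdgesT with hN
  set ρ : Edge d L → GaugeConfig d L G → ℝ := fun x σ =>
    Real.exp (torusLogWeight v (update σ x (sel x)) - torusLogWeight v σ) with hρ
  have hρm : ∀ x, Measurable (ρ x) := fun x => measurable_exp_update_sub hv x (sel x)
  have hρb : ∀ x σ, Real.exp (-D) ≤ ρ x σ ∧ ρ x σ ≤ Real.exp D := fun x σ => exp_update_sub_bounds hvδ x (sel x) σ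
  have hD0 : 0 ≤ D := by positivity
  have hgap : 0 ≤ Real.exp D - Real.exp (-D) := sub_nonneg.2 (Real.exp_le_exp.2 (by linarith))
  set cov : Edge d L → ℝ := fun e' => (∫ σ, ρ e σ * ρ e' σ ∂ν) - (∫ σ, ρ e σ ∂ν) * (∫ σ, ρ e' σ ∂ν) with hcov
  -- near pairs
  have hnear : ∀ e', |cov e'| ≤ (Real.exp D - Real.exp (-D)) ^ 2 := fun e' =>
    abs_cov_le_sq_of_bounds ν (hρm e) (hρm e') (Real.exp_pos _).le (hρb e) (hρb e')
  -- far pairs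
  have hfar : ∀ e' ∈ Λᶜ, e' ∉ N → |cov e'| ≤
      Real.exp D * (Real.exp D - Real.exp (-D)) * ∑ z ∈ N, α ^ max 1 (torusNorm (z.1 - e'.1)) :=
    fun e' he' hfar' => abs_cov_tilt_far hv hv0 hvδ hα hα1 Λ η (Finset.mem_compl.1 he') hfar' (sel e) (sel e')
  -- split the row into near and far pairs
  rw [← sum_filter_add_sum_filter_not Λᶜ (fun e' => e' ∈ N), mul_add]
  refine add_le_add ?_ ?_
  · calc ∑ e' ∈ Λᶜ.filter (fun e' => e' ∈ N), |cov e'|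
        ≤ ∑ _e' ∈ Λᶜ.filter (fun e' => e' ∈ N), (Real.exp D - Real.exp (-D)) ^ 2 := sum_le_sum fun e' _ => hnear e'
      _ = (Λᶜ.filter (fun e' => e' ∈ N)).card * (Real.exp D - Real.exp (-D)) ^ 2 := by rw [sum_const, nsmul_eq_mul]
      _ ≤ (8 * (d - 1 : ℕ) : ℝ) * (Real.exp D - Real.exp (-D)) ^ 2 := by
          refine mul_le_mul_of_nonneg_right ?_ (sq_nonneg _)
          have h1 : (Λᶜ.filter (fun e' => e' ∈ N)).card ≤ N.card :=
            card_le_card fun e' he' => (mem_filter.1 he').2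
          exact_mod_cast h1.trans (card_plaqNbhd_le e)
      _ = 8 * (d - 1 : ℕ) * (Real.exp D - Real.exp (-D)) ^ 2 := by ring
  · calc ∑ e' ∈ Λᶜ.filter (fun e' => e' ∉ N), |cov e'|
        ≤ ∑ e' ∈ Λᶜ.filter (fun e' => e' ∉ N),
            Real.exp D * (Real.exp D - Real.exp (-D)) * ∑ z ∈ N, α ^ max 1 (torusNorm (z.1 - e'.1)) :=
          sum_le_sum fun e' he' => hfar e' (mem_filter.1 he').1 (mem_filter.1 he').2
      _ ≤ ∑ e' : Edge d L, Real.exp D * (Real.exp D - Real.exp (-D)) * ∑ z ∈ N, α ^ max 1 (torusNorm (z.1 - e'.1)) :=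
          sum_le_sum_of_subset_of_nonneg (subset_univ _) fun e' _ _ =>
            mul_nonneg (mul_nonneg (Real.exp_pos _).le hgap) (sum_nonneg fun z _ => pow_nonneg hα0 _)
      _ = Real.exp D * (Real.exp D - Real.exp (-D)) * ∑ z ∈ N, ∑ e' : Edge d L, α ^ max 1 (torusNorm (z.1 - e'.1)) := by
          rw [← mul_sum, sum_comm]
      _ ≤ Real.exp D * (Real.exp D - Real.exp (-D)) * ∑ _z ∈ N, (d * ((1 + 2 * (3 : ℝ) ^ d) * α)) := by
          refine mul_le_mul_of_nonneg_left (sum_le_sum fun z _ => sum_links_pow_max_torusNorm_le hα0 hα2 z) ?_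
          exact mul_nonneg (Real.exp_pos _).le hgap
      _ = Real.exp D * (Real.exp D - Real.exp (-D)) * (N.card * (d * ((1 + 2 * (3 : ℝ) ^ d) * α))) := by
          rw [sum_const, nsmul_eq_mul]
      _ ≤ Real.exp D * (Real.exp D - Real.exp (-D)) * ((8 * (d - 1 : ℕ) : ℝ) * (d * ((1 + 2 * (3 : ℝ) ^ d) * α))) := by
          refine mul_le_mul_of_nonneg_left (mul_le_mul_of_nonneg_right ?_ (by positivity)) ?_
          · exact_mod_cast card_plaqNbhd_le e
          · exact mul_nonneg (Real.exp_pos _).le hgap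
      _ = 8 * (d - 1 : ℕ) * (Real.exp D * (Real.exp D - Real.exp (-D)) * (d * ((1 + 2 * (3 : ℝ) ^ d) * α))) := by
          ring

end Row

end Summit.QuantumFields.YangMills.Cruxes.IR.ShellMaxCorr.TorusTilt

end
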